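import Mathlib
import HarnessLib
import HarnessLib.Audit
import Summits.CriticalPhenomena.PercolationContinuityZ3.Theorems.PercNearOneGluingNoHeavyLowerTailHexMSMatchTightInsert

/-!
# Conjecture (MATCH), two dead classes: reduction to the absence of hard-core families (hp-7 gen 70)

Support file for crux `stmt-CriticalPhenomena-4575` (route `PercNearOneGluingNoHeavy`), hull-port seat `prim-hp-7` (generation 70);
`--supports stmt-CriticalPhenomena-4575`.  No `sorry`, no definition.  Memo: `run/shared/lean/prim/prim-hp-7/FROM-prim-hp-7-g70-MS-EQUALITY.md` §0 (ABSORB)/(NHC).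

The induction skeleton behind gen 70's (ABSORB) reformulation, specialised to two adjacent dead classes.  A two-class dead family `F`
(`#F ≥ 3`) is HARD-CORE if every maximal subfamily `F.erase s` is Hall-tight (`#cl(F∖s) = #N(cl(F∖s))`) and not Marica–Schönheim-tight.

* `card_eq_two_mul_of_complClosed` — a complement-closed family of subsets of `U ≠ ∅` has even cardinality;
* `biUnion_candidates_cl_complClosed` — `N(cl F)` is complement-closed inside `𝒫 U`;
* `card_cl_le_card_biUnion_candidates_of_noHardCore` — **if the instance has no hard-core family then Hall's condition `#cl F ≤ #N(cl F)` holds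
  for every two-class dead family `F`** (strong induction on `#F`: `F.erase s` MS-tight ⟹ `…HexMSMatchTightInsert`; `F.erase s` not Hall-tight ⟹
  slack `≥ 2` by parity; `#F ≤ 2` always has an MS-tight `F.erase s`).  The census of gen 70 (kit j237675 + local, `code/gen70/pairs.c`) found
  NO hard-core family among ≈ 2.6·10⁷ two-class families on `2^[5]`, 3·10⁵ on `2^[4]`, 3·10⁵ on `2^[6]`; proving their absence would settle
  two-class (MATCH).
-/

namespace Summit.CriticalPhenomena.PercolationContinuityZ3.Theorems

namespace GeneratedDonors

open Finset FinsetFamily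

variable {α : Type*} [DecidableEq α]

section TwoClassReduction

/-! ### Two dead classes: reduction of Hall's condition to the absence of 'hard-core' families -/

variable {U : Finset α} {𝒟 : Finset (Finset α)} {x : Finset α → ZMod 6}

/-- A complement-closed family of subsets of a set `U ∋ v` has even cardinality: complementation is a bijection between the members
containing `v` and those avoiding it. -/
theorem card_eq_two_mul_of_complClosed {X : Finset (Finset α)} (hXU : ∀ w ∈ X, w ⊆ U) (hX : ∀ w ∈ X, U \ w ∈ X)
    {v : α} (hv : v ∈ U) : #X = 2 * #(X.filter fun w => v ∈ w) := by
  classical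
  have hcc : ∀ a : Finset α, a ⊆ U → U \ (U \ a) = a := fun a ha => Finset.sdiff_sdiff_eq_self ha
  have himg : X.filter (fun w => v ∉ w) = (X.filter fun w => v ∈ w).image (fun w => U \ w) := by
    ext w
    rw [mem_filter, mem_image]
    constructor
    · rintro ⟨hw, hvw⟩
      refine ⟨U \ w, mem_filter.mpr ⟨hX w hw, mem_sdiff.mpr ⟨hv, hvw⟩⟩, hcc w (hXU w hw)⟩
    · rintro ⟨w', hw', rfl⟩
      rw [mem_filter] at hw'
      exact ⟨hX w' hw'.1, fun h => (mem_sdiff.mp h).2 hw'.2⟩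
  have hinj : Set.InjOn (fun w : Finset α => U \ w) ↑(X.filter fun w => v ∈ w) := by
    intro p hp q hq hpq
    have hpU : p ⊆ U := hXU p (mem_filter.mp (mem_coe.mp hp)).1
    have hqU : q ⊆ U := hXU q (mem_filter.mp (mem_coe.mp hq)).1
    have h1 := congrArg (fun t => U \ t) hpq
    simp only [hcc p hpU, hcc q hqU] at h1
    exact h1
  have h := card_filter_add_card_filter_not (s := X) (fun w => v ∈ w)
  rw [himg, card_image_of_injOn hinj] at h
  omega

/-- The candidate set `N(cl F)` of the complement closure of a family `F ⊆ 𝒟` is complement-closed and lives in `𝒫 U`. -/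
theorem biUnion_candidates_cl_complClosed (hU : ∀ a ∈ 𝒟, a ⊆ U) (hco : ∀ a ∈ 𝒟, U \ a ∈ 𝒟)
    (hanti : ∀ a ∈ 𝒟, x (U \ a) = x a + 3) {F : Finset (Finset α)} (hFD : ∀ f ∈ F, f ∈ 𝒟) :
    (∀ w ∈ (F ∪ F.image fun f => U \ f).biUnion (candidates 𝒟 x), w ⊆ U) ∧
    (∀ w ∈ (F ∪ F.image fun f => U \ f).biUnion (candidates 𝒟 x), U \ w ∈ (F ∪ F.image fun f => U \ f).biUnion (candidates 𝒟 x)) := by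
  have hcc : ∀ a : Finset α, a ⊆ U → U \ (U \ a) = a := fun a ha => Finset.sdiff_sdiff_eq_self ha
  have hAD : ∀ a ∈ F ∪ F.image (fun f => U \ f), a ∈ 𝒟 := by
    intro a ha
    rcases mem_union.mp ha with h | h
    · exact hFD a h
    · obtain ⟨f, hf, rfl⟩ := mem_image.mp h; exact hco f (hFD f hf)
  have hAcl : ∀ a ∈ F ∪ F.image (fun f => U \ f), U \ a ∈ F ∪ F.image (fun f => U \ f) := by
    intro a ha
    rcases mem_union.mp ha with h | h
    · exact mem_union_right _ (mem_image_of_mem _ h)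
    · obtain ⟨f, hf, rfl⟩ := mem_image.mp h
      rw [hcc f (hU f (hFD f hf))]; exact mem_union_left _ hf
  constructor
  · intro w hw
    obtain ⟨a, ha, hwa⟩ := mem_biUnion.mp hw
    exact candidates_subset_ground hU (hAD a ha) hwa
  · intro w hw
    obtain ⟨a, ha, hwa⟩ := mem_biUnion.mp hw
    refine mem_biUnion.mpr ⟨U \ a, hAcl a ha, ?_⟩
    rw [candidates_compl hU hco hanti (hAD a ha)]
    exact mem_image_of_mem _ hwa

/-- **Two-class (MATCH) reduces to the absence of hard-core families.**  Call a two-class dead family `F` (labels in `{ℓ, ℓ+1}`, `#F ≥ 3`)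
HARD-CORE if for EVERY `s ∈ F` the maximal subfamily `F.erase s` is Hall-tight (`#cl(F∖s) = #N(cl(F∖s))`) but not MS-tight.  If the instance
has no hard-core family, Hall's condition `#cl F ≤ #N(cl F)` holds for every two-class dead family `F`: induction on `#F` — a tight `F.erase s`
is handled by `…HexMSMatchTightInsert`, a non-Hall-tight one gives slack `≥ 2` by parity (both cardinalities are even).  Gen 70 census
(`code/gen70/pairs.c`, kit j237675): 0 hard-core families among ≈ 2.6·10⁷ two-class families on `2^[5]` and 3·10⁵ on `2^[6]` (annealed instances). -/
theorem card_cl_le_card_biUnion_candidates_of_noHardCore (hU : ∀ a ∈ 𝒟, a ⊆ U) (hco : ∀ a ∈ 𝒟, U \ a ∈ 𝒟)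
    (hanti : ∀ a ∈ 𝒟, x (U \ a) = x a + 3) (ℓ : ZMod 6)
    (hNHC : ∀ F : Finset (Finset α), F ⊆ dead U 𝒟 x → (∀ f ∈ F, x f = ℓ ∨ x f = ℓ + 1) → 3 ≤ #F →
      ∃ s ∈ F, #((F.erase s) \\ (F.erase s)) = #(F.erase s) ∨
        #(F.erase s ∪ (F.erase s).image fun f => U \ f) ≠ #((F.erase s ∪ (F.erase s).image fun f => U \ f).biUnion (candidates 𝒟 x)))
    {F : Finset (Finset α)} (hF : F ⊆ dead U 𝒟 x) (hlab : ∀ f ∈ F, x f = ℓ ∨ x f = ℓ + 1) :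
    #(F ∪ F.image fun f => U \ f) ≤ #((F ∪ F.image fun f => U \ f).biUnion (candidates 𝒟 x)) := by
  classical
  -- strong induction on `#F`
  suffices H : ∀ n, ∀ F : Finset (Finset α), #F = n → F ⊆ dead U 𝒟 x → (∀ f ∈ F, x f = ℓ ∨ x f = ℓ + 1) →
      #(F ∪ F.image fun f => U \ f) ≤ #((F ∪ F.image fun f => U \ f).biUnion (candidates 𝒟 x)) from H _ F rfl hF hlab
  intro n
  induction n using Nat.strong_induction_on with
  | _ n ih =>
    intro F hFn hF hlab
    have hFD : ∀ f ∈ F, f ∈ 𝒟 := fun f hf => (mem_filter.mp (hF hf)).1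
    -- the insertion step: `F = insert s (F.erase s)` with `F.erase s` MS-tight
    have step_tight : ∀ s ∈ F, #((F.erase s) \\ (F.erase s)) = #(F.erase s) →
        #(F ∪ F.image fun f => U \ f) ≤ #((F ∪ F.image fun f => U \ f).biUnion (candidates 𝒟 x)) := by
      intro s hs ht
      have hF' : F.erase s ⊆ dead U 𝒟 x := fun f hf => hF (mem_of_mem_erase hf)
      have hlab' : ∀ f ∈ F.erase s, x f = ℓ ∨ x f = ℓ + 1 := fun f hf => hlab f (mem_of_mem_erase hf)
      have hsF : s ∉ F.erase s := notMem_erase s F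
      have heq : insert s (F.erase s) = F := insert_erase hs
      rcases hlab s hs with h0 | h1
      · have h := card_le_card_biUnion_candidates_of_tight_insert' hU hco hanti hF' hlab' ht (hF hs) h0 hsF
        rwa [heq] at h
      · have h := card_le_card_biUnion_candidates_of_tight_insert hU hco hanti hF' hlab' ht (hF hs) h1 hsF
        rwa [heq] at h
    rcases Nat.lt_or_ge n 3 with hsmall | hbig
    · -- `#F ≤ 2`
      rcases F.eq_empty_or_nonempty with rfl | ⟨s, hs⟩
      · simp
      · -- `F.erase s` has at most one member, hence is MS-tight
        refine step_tight s hs ?_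
        have hcard : #(F.erase s) ≤ 1 := by have := card_erase_of_mem hs; omega
        rcases (F.erase s).eq_empty_or_nonempty with h0 | ⟨a, ha⟩
        · rw [h0]; simp
        · have h1 : F.erase s = {a} := by
            apply (eq_singleton_iff_unique_mem).mpr
            exact ⟨ha, fun b hb => by
              by_contra hne
              have : 2 ≤ #(F.erase s) := by
                have : ({a, b} : Finset (Finset α)) ⊆ F.erase s := by
                  intro c hc; rw [mem_insert, mem_singleton] at hc; rcases hc with rfl | rfl; exact ha; exact hb
                have h2 := card_le_card this
                rw [card_pair (Ne.symm hne)] at h2; exact h2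
              omega⟩
          rw [h1, Finset.diffs_singleton, image_singleton, Finset.sdiff_self, card_singleton, card_singleton]
    · obtain ⟨s, hs, hcase⟩ := hNHC F hF hlab (by omega)
      rcases hcase with ht | hne
      · exact step_tight s hs ht
      · -- `F.erase s` is not Hall-tight: by induction it satisfies Hall, and both sides are even, so the slack is ≥ 2
        set F' := F.erase s with hF'def
        have hF' : F' ⊆ dead U 𝒟 x := fun f hf => hF (mem_of_mem_erase hf)
        have hlab' : ∀ f ∈ F', x f = ℓ ∨ x f = ℓ + 1 := fun f hf => hlab f (mem_of_mem_erase hf)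
        have hF'D : ∀ f ∈ F', f ∈ 𝒟 := fun f hf => hFD f (mem_of_mem_erase hf)
        have hIH := ih (#F') (by rw [hF'def, card_erase_of_mem hs]; omega) F' rfl hF' hlab'
        -- parity
        have hsD : s ∈ 𝒟 := hFD s hs
        obtain ⟨v, hv⟩ : U.Nonempty := by
          obtain ⟨i, hi⟩ := inter_nonempty_of_dead_of_close (hF hs) hsD (Or.inl rfl)
          exact ⟨i, hU s hsD (mem_inter.mp hi).1⟩
        have hcc : ∀ a : Finset α, a ⊆ U → U \ (U \ a) = a := fun a ha => Finset.sdiff_sdiff_eq_self ha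
        have hclU : ∀ w ∈ F' ∪ F'.image (fun f => U \ f), w ⊆ U := by
          intro w hw
          rcases mem_union.mp hw with h | h
          · exact hU w (hF'D w h)
          · obtain ⟨f, _, rfl⟩ := mem_image.mp h; exact sdiff_subset
        have hclcl : ∀ w ∈ F' ∪ F'.image (fun f => U \ f), U \ w ∈ F' ∪ F'.image (fun f => U \ f) := by
          intro w hw
          rcases mem_union.mp hw with h | h
          · exact mem_union_right _ (mem_image_of_mem _ h)
          · obtain ⟨f, hf, rfl⟩ := mem_image.mp h
            rw [hcc f (hU f (hF'D f hf))]; exact mem_union_left _ hf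
        obtain ⟨hNU, hNcl⟩ := biUnion_candidates_cl_complClosed hU hco hanti hF'D
        have heven₁ := card_eq_two_mul_of_complClosed hclU hclcl hv
        have heven₂ := card_eq_two_mul_of_complClosed hNU hNcl hv
        -- monotonicity `N(cl F') ⊆ N(cl F)` and `#cl F ≤ #cl F' + 2`
        have hmono : (F' ∪ F'.image fun f => U \ f) ⊆ (F ∪ F.image fun f => U \ f) :=
          union_subset_union (erase_subset s F) (image_subset_image (erase_subset s F))
        have h1 := card_le_card (biUnion_subset_biUnion_of_subset_left (candidates 𝒟 x) hmono)
        have h2 : #(F ∪ F.image fun f => U \ f) ≤ #(F' ∪ F'.image fun f => U \ f) + 2 := by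
          have hsub : (F ∪ F.image fun f => U \ f) ⊆ (F' ∪ F'.image fun f => U \ f) ∪ {s, U \ s} := by
            intro w hw
            rw [mem_union, mem_insert, mem_singleton]
            rcases mem_union.mp hw with h | h
            · by_cases hws : w = s
              · exact Or.inr (Or.inl hws)
              · exact Or.inl (mem_union_left _ (mem_erase.mpr ⟨hws, h⟩))
            · obtain ⟨f, hf, rfl⟩ := mem_image.mp h
              by_cases hfs : f = s
              · exact Or.inr (Or.inr (by rw [hfs]))
              · exact Or.inl (mem_union_right _ (mem_image_of_mem _ (mem_erase.mpr ⟨hfs, hf⟩)))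
          have h3 := (card_le_card hsub).trans (card_union_le _ _)
          have h4 : #({s, U \ s} : Finset (Finset α)) ≤ 2 := card_insert_le _ _ |>.trans (by rw [card_singleton])
          omega
        omega

end TwoClassReduction

end GeneratedDonors

end Summit.CriticalPhenomena.PercolationContinuityZ3.Theorems
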